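import Summits.ResolutionOfSingularities.ResolutionOfSingularities.Theorems.FrobeniusLadderFInjectiveMacaulayficationRegularBlowupModelDim2
import Summits.ResolutionOfSingularities.ResolutionOfSingularities.Theorems.FrobeniusLadderFInjectiveMacaulayficationAffineBlowupChartTransport
import HarnessLib

/-!
# A NORMAL AFFINE NEIGHBOURHOOD of a normal point of a variety (pointed finiteness of normalisation) — input of the T-line rung T2
# (crux `FInjectiveMacaulayfication` stmt-ResolutionOfSingularities-15315, chain w45a; res-L1-w45a-plan-1 R13.46 (2); prover res-L1-w45a-stub-4)

[OURS · L1 W4.5a] Support file (`--supports stmt-ResolutionOfSingularities-15315 --as helper`); NOT a statement of any manuscript;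
no definitions, no named facts (E. Noether's finiteness of the integral closure is the tree THEOREM `NoetherFiniteIntegralClosure_holds`);
AI-written (AI review is weaker than expert review).

* `exists_isIntegrallyClosed_localization_away_of_atPrime` — POINTED COMMON DENOMINATOR: if the integral closure of a domain `A` in its
  fraction field is a finite `A`-module and `A_𝔭` is integrally closed, then `A[1/s]` is integrally closed for some `s ∉ 𝔭` (every
  generator of the integral closure lies in `A_𝔭`, i.e. has a denominator outside `𝔭`; the product of these denominators kills all
  denominators of integral elements — then the argument of `ResolutionOfCurves.exists_isIntegrallyClosed_localization_away` verbatim).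
* `exists_normal_affineOpen` — for an integral scheme locally of finite type over a field and a point `b` with integrally closed
  local ring: an affine open `U ∋ b` with `Γ(X, U)` integrally closed and ALL local rings of points of `U` integrally closed (the
  normalisation is an isomorphism over `U`, `ResolutionOfCurves.isIso_normalizationι_morphismRestrict`).

[folklore; cite: Liu2002, Prop. 4.1.27 and Cor. 4.1.30 (finiteness of normalisation)]
-/

-- single-problem summit: the doubled namespace component is forced
set_option linter.dupNamespace false

noncomputable section

open AlgebraicGeometry CategoryTheory Literature.AlgebraicGeometry.Resolution TopologicalSpace

namespace Summit.ResolutionOfSingularities.ResolutionOfSingularities.Theorems.FInjectiveMacaulayfication.NormalAffineNeighbourhood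

open Summit.ResolutionOfSingularities.ResolutionOfSingularities.Theorems.FInjectiveMacaulayfication

/-! ## §1 Pointed common denominator -/

/-- **Pointed common denominator.** Let `A` be a domain with fraction field `K` whose integral closure in `K` is a finite `A`-module,
and `𝔭` a prime with `A_𝔭` integrally closed. Then `A[1/s]` is integrally closed for some `s ∉ 𝔭`. [folklore] -/
theorem exists_isIntegrallyClosed_localization_away_of_atPrime (A K : Type*) [CommRing A] [IsDomain A] [Field K] [Algebra A K]
    [IsFractionRing A K] (hfin : Module.Finite A (integralClosure A K)) (P : Ideal A) [P.IsPrime]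
    (hP : IsIntegrallyClosed (Localization.AtPrime P)) :
    ∃ s : A, s ∉ P ∧ IsIntegrallyClosed (Localization.Away s) := by
  classical
  obtain ⟨S, hS⟩ := hfin.fg_top
  -- `A_𝔭` inside `K`
  set L := Localization.AtPrime P
  letI : Algebra L K := (IsLocalization.map (M := P.primeCompl) (T := nonZeroDivisors A) K (RingHom.id A)
    (fun y hy => mem_nonZeroDivisors_of_ne_zero fun h => hy (h ▸ P.zero_mem))).toAlgebra
  haveI : IsScalarTower A L K := IsScalarTower.of_algebraMap_eq' (by
    rw [RingHom.algebraMap_toAlgebra, IsLocalization.map_comp, RingHomCompTriple.comp_eq])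
  haveI : IsFractionRing L K := IsFractionRing.isFractionRing_of_isDomain_of_isLocalization P.primeCompl L K
  -- every generator `z` has a denominator outside `𝔭`: `s_z • z ∈ A`
  have hgen : ∀ z : integralClosure A K, ∃ s : A, s ∉ P ∧ IsLocalization.IsInteger A (s • (z : K)) := by
    intro z
    have hz : IsIntegral L (z : K) := z.2.tower_top
    obtain ⟨w, hw⟩ := (IsIntegrallyClosed.isIntegral_iff (R := L) (K := K)).mp hz
    obtain ⟨⟨a, t⟩, rfl⟩ := IsLocalization.mk'_surjective P.primeCompl w
    refine ⟨t, t.2, a, ?_⟩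
    have h1 : algebraMap L K (IsLocalization.mk' L a t) * algebraMap A K (t : A) = algebraMap A K a := by
      rw [IsScalarTower.algebraMap_apply A L K (t : A), ← map_mul, IsLocalization.mk'_spec, ← IsScalarTower.algebraMap_apply]
    rw [hw] at h1
    rw [Algebra.smul_def, mul_comm, h1]
  choose sz hszP hsz using hgen
  -- the product of the denominators of the generators
  refine ⟨∏ z ∈ S, sz z, ?_, ?_⟩
  · exact fun h => by
      obtain ⟨z, -, hz⟩ := Ideal.IsPrime.prod_mem_iff.mp h
      exact hszP z hz
  set d := ∏ z ∈ S, sz z with hd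
  have hd0 : d ≠ 0 := fun h => by
    have : d ∈ P := h ▸ P.zero_mem
    obtain ⟨z, -, hz⟩ := Ideal.IsPrime.prod_mem_iff.mp this
    exact hszP z hz
  -- `d` kills the denominators of every integral element
  have hdint : ∀ x : integralClosure A K, IsLocalization.IsInteger A (d • (x : K)) := by
    intro x
    have hx : x ∈ Submodule.span A (S : Set (integralClosure A K)) := by rw [hS]; trivial
    refine Submodule.span_induction ?_ ?_ ?_ ?_ hx
    · intro b hb
      obtain ⟨a, ha⟩ := hsz b
      refine ⟨(∏ z ∈ S.erase b, sz z) * a, ?_⟩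
      rw [hd, ← Finset.prod_erase_mul S sz hb, mul_smul, map_mul, ← ha, Algebra.smul_def]
    · exact ⟨0, by simp⟩
    · rintro x y - - ⟨a, ha⟩ ⟨b, hb⟩
      refine ⟨a + b, ?_⟩
      simp only [map_add, ha, hb, Subalgebra.coe_add, smul_add]
    · rintro a x - ⟨b, hb⟩
      refine ⟨a * b, ?_⟩
      rw [Subalgebra.coe_smul, smul_comm, ← hb, map_mul, Algebra.smul_def]
  -- `B = A[1/d]` with fraction field `K` is integrally closed (as in `exists_isIntegrallyClosed_localization_away`)
  set B := Localization.Away d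
  letI : Algebra B K := (IsLocalization.map (M := Submonoid.powers d) (T := nonZeroDivisors A) K
    (RingHom.id A) (Submonoid.powers_le.mpr (mem_nonZeroDivisors_of_ne_zero hd0))).toAlgebra
  haveI : IsScalarTower A B K := IsScalarTower.of_algebraMap_eq' (by
    rw [RingHom.algebraMap_toAlgebra, IsLocalization.map_comp, RingHomCompTriple.comp_eq])
  haveI : IsFractionRing B K :=
    IsFractionRing.isFractionRing_of_isDomain_of_isLocalization (Submonoid.powers d) B K
  refine (isIntegrallyClosed_iff K).mpr fun {x} hx => ?_
  obtain ⟨⟨_, n, rfl⟩, hn⟩ :=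
    IsIntegral.exists_multiple_integral_of_isLocalization (Submonoid.powers d) (Rₘ := B) x hx
  obtain ⟨a, ha⟩ := hdint ⟨_, hn⟩
  let t : Submonoid.powers d := ⟨d ^ (n + 1), n + 1, rfl⟩
  refine ⟨IsLocalization.mk' B a t, ?_⟩
  have hK : algebraMap A K (d ^ (n + 1)) * x = algebraMap A K a := by
    rw [ha]
    simp only [Submonoid.smul_def, Algebra.smul_def, pow_succ, map_mul, map_pow]
    ring
  have hne : algebraMap A K (d ^ (n + 1)) ≠ 0 :=
    (map_ne_zero_iff _ (IsFractionRing.injective A K)).mpr (pow_ne_zero _ hd0)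
  have : algebraMap B K (IsLocalization.mk' B a t) * algebraMap A K (d ^ (n + 1)) = algebraMap A K a := by
    rw [IsScalarTower.algebraMap_apply A B K (d ^ (n + 1)), ← map_mul,
      show algebraMap A B (d ^ (n + 1)) = algebraMap A B (t : A) from rfl,
      IsLocalization.mk'_spec B a t, ← IsScalarTower.algebraMap_apply]
  calc algebraMap B K (IsLocalization.mk' B a t)
      = algebraMap A K a / algebraMap A K (d ^ (n + 1)) := by rw [eq_div_iff hne, this]
    _ = x := by rw [← hK, mul_comm, mul_div_assoc, div_self hne, mul_one]

/-! ## §2 The normal affine neighbourhood -/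

/-- **A normal point of a variety has a normal affine neighbourhood**: for `X` integral, locally of finite type over a field, and
`b ∈ X` with `𝒪_{X,b}` integrally closed, there is an affine open `U ∋ b` with `Γ(X, U)` integrally closed and all local rings of
points of `U` integrally closed. [folklore; cite: Liu2002, Cor. 4.1.30] -/
theorem exists_normal_affineOpen {k : Type} [Field k] (X : Scheme.{0}) [IsIntegral X] (f : X ⟶ Spec (.of k))
    [LocallyOfFiniteType f] (b : X) (hb : IsIntegrallyClosed (X.presheaf.stalk b)) :
    ∃ U : X.Opens, IsAffineOpen U ∧ b ∈ U ∧ IsIntegrallyClosed Γ(X, U) ∧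
      ∀ u : X, u ∈ U → IsIntegrallyClosed (X.presheaf.stalk u) := by
  obtain ⟨_, ⟨U₀, hU₀, rfl⟩, hbU₀, -⟩ := X.isBasis_affineOpens.exists_subset_of_mem_open (Set.mem_univ b) isOpen_univ
  haveI : Nonempty U₀ := ⟨⟨b, hbU₀⟩⟩
  -- `A = Γ(X, U₀)` is a finitely generated `k`-domain with fraction field `K(X)`
  let A := Γ(X, U₀)
  let φ : k →+* A := (f.appLE ⊤ U₀ le_top).hom.comp (Scheme.ΓSpecIso (.of k)).inv.hom
  have hφ : φ.FiniteType := by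
    refine RingHom.FiniteType.comp ?_ (RingHom.FiniteType.of_surjective _
      (Scheme.ΓSpecIso (.of k)).symm.commRingCatIsoToRingEquiv.surjective)
    exact HasRingHomProperty.appLE @LocallyOfFiniteType f ‹_› ⟨⊤, isAffineOpen_top _⟩ ⟨U₀, hU₀⟩ le_top
  letI : Algebra k A := φ.toAlgebra
  haveI : Algebra.FiniteType k A := hφ
  haveI : IsFractionRing A X.functionField := functionField_isFractionRing_of_isAffineOpen X U₀ hU₀
  -- the prime of `b` and `A_𝔭 ≅ 𝒪_{X,b}` integrally closed
  let P : Ideal A := (hU₀.primeIdealOf ⟨b, hbU₀⟩).asIdeal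
  letI := TopCat.Presheaf.algebra_section_stalk X.presheaf (⟨b, hbU₀⟩ : (U₀ : X.Opens))
  haveI : IsLocalization.AtPrime (X.presheaf.stalk b) P := hU₀.isLocalization_stalk ⟨b, hbU₀⟩
  have hP : IsIntegrallyClosed (Localization.AtPrime P) :=
    IsIntegrallyClosed.of_equiv (IsLocalization.algEquiv P.primeCompl (X.presheaf.stalk b) (Localization.AtPrime P)).toRingEquiv
  obtain ⟨s, hsP, hs⟩ := exists_isIntegrallyClosed_localization_away_of_atPrime A X.functionField
    (NoetherFiniteIntegralClosure_holds.self k A X.functionField) P hP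
  -- `U = D(s)`
  have hbs : b ∈ X.basicOpen s := by
    by_contra h
    exact hsP ((AffineBlowupChartTransport.mem_primeIdealOf_iff_not_mem_basicOpen ⟨U₀, hU₀⟩ hbU₀ s).mpr h)
  have hic : IsIntegrallyClosed Γ(X, X.basicOpen s) := by
    haveI := hU₀.isLocalization_basicOpen s
    exact IsIntegrallyClosed.of_equiv
      (IsLocalization.algEquiv (Submonoid.powers s) (Localization.Away s) Γ(X, X.basicOpen s)).toRingEquiv
  refine ⟨X.basicOpen s, hU₀.basicOpen s, hbs, hic, fun u hu => ?_⟩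
  -- the normalisation is an isomorphism over `D(s)`; transport normality of its stalks
  haveI : IsIso (normalizationι X ∣_ X.basicOpen s) := isIso_normalizationι_morphismRestrict X (hU₀.basicOpen s) ⟨b, hbs⟩ hic
  obtain ⟨x₃, rfl⟩ := RegularBlowupModelDim2.exists_preimage_of_isIso_morphismRestrict (normalizationι X) (X.basicOpen s) u hu
  haveI := RegularBlowupModelDim2.isIso_stalkMap_of_isIso_morphismRestrict (normalizationι X) (X.basicOpen s) x₃ hu
  haveI := isIntegrallyClosed_stalk_normalization X x₃
  exact IsIntegrallyClosed.of_equiv (asIso ((normalizationι X).stalkMap x₃)).commRingCatIsoToRingEquiv.symm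

end Summit.ResolutionOfSingularities.ResolutionOfSingularities.Theorems.FInjectiveMacaulayfication.NormalAffineNeighbourhood

end
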